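import Summits.BirchSwinnertonDyer.BirchSwinnertonDyer.Theorems.KolyvaginRoadThreeCruxIffLeaf
import Summits.BirchSwinnertonDyer.Rank1Residual.X11b.Three.KolyvaginLine
import Summits.BirchSwinnertonDyer.Rank1Residual.X11b.RingClassFieldNoTorsion
import HarnessLib

/-!
# Route `KolyvaginRoadThree`, deciding crux `ZhangSharpFrameAtThreeHL` (item stmt-BirchSwinnertonDyer-19574),
# skeleton v2y, stub S1 `stub_bottomRankOneAtThree`: the PER-PAIR CERTIFICATE of the conductor-one class —
# `c₁(1) ≢ 0 (mod 3) ⟺ y_K ∉ 3·E(K)`, for EVERY conductor-1 Kolyvagin–Heegner datum of the frame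
# (cell `bsd-stepL`, ACCEL seat `bsd-stepL-koly3b` g3; `--supports stmt-BirchSwinnertonDyer-19574`, helper)

HONEST FRAMING. Nothing about BSD, Kolyvagin's conjecture or Schneider's conjecture is asserted; Shimura reciprocity
at conductor 1 (`heegnerPointOfConductor_one_galoisConj`) and Gross 1991 §3 (`phi_heegnerPointOfConductor_mem_range_map_
ringClassField`, `exists_generator_ringClassGalOver`) enter as BINDERS (published named facts of the tree). THEOREMS
ONLY (0 definitions, 0 named facts, 0 `sorry`). PARTITION: O2@3 (B10) × A1 × crux 19574 × stub S1 —
types-the-object-of (the per-pair certificate currency of S1: «per-pair certificate = the Heegner index mod 3, no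
derived classes», plan g27 23:40:43Z ∕ plan g28 01:08:28Z); closes: none (T7).

WHAT. On a frame `(K, Dt, β, ι)` of `E/ℚ` (multiplicative at `3`, `ρ̄_{E,3}` onto, `K` imaginary quadratic Heegner
for `N_E`, `4N ∣ β² − d_K`) with Heegner point `P = y_K ∈ E(K)` (its complex point under `ι` is
`heegnerPointComplex Dt H`, `H.β = β`), for EVERY Kolyvagin–Heegner datum `d` of conductor `1` on the frame:

  `d.kolyvaginClass Nat.prime_three 1 ≠ 0 ↔ ¬ ∃ Q ∈ E(K), 3 • Q = P`

(`kolyvaginClass_conductorOne_ne_zero_iff_not_divisible`): Gross's `P(1) = y_K`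
(`KolyvaginBottom.eq_of_map_eq_heegnerPointComplex`), `E(K[1])[3] = 0` (Gross Lemma 4.3,
`RingClassNoTorsion.eq_zero_of_zsmul_pow_eq_zero_ringClassField`) so that `3 ∣ P(1)` in `E(K[1])` iff `3 ∣ y_K` in
`E(K)` (McCallum Lemma 5.1, `pDiv_one_iff_exists_zsmul_eq`), and McCallum Cor. 4.5 at conductor 1 (`c₁(1) = 0 ⟺
3 ∣ P(1)`, tree `KolyCert.kolyvaginClass_three_ne_zero_iff` ∕ `…_of_tower_not_pDiv`). Consequences: the S1
conclusion `∃ d : KolyvaginHeegnerData Dt β ι 1, c₁(1) ≠ 0` from the ONE per-pair input `y_K ∉ 3E(K)` — i.e.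
`3 ∤ [E(K) : ℤ y_K]` when `E(K) ≅ ℤ ⊕ (prime-to-3)` — (`exists_kolyvaginClass_conductorOne_ne_zero_of_not_divisible`;
the datum exists by Gross §3, `nonempty_kolyvaginHeegnerData_of_grossCM`), and conversely S1's conclusion forces
`y_K ∉ 3E(K)` (`not_divisible_of_kolyvaginClass_conductorOne_ne_zero`). So S1's rungs are index certificates
(the cell's REG3CERT ∕ GZ-index kits certify `3 ∤ I_K`), with no derived Heegner points.

References: [cite: McCallumLMS1991, §4 (5), Cor. 4.5, §5 Lemma 5.1 (p. 303)] [cite: GrossLMS1991, §3, Prop. 3.6,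
Lemma 4.3, §4 (P_1 = y_K)] [cite: WZhang2014, Thm. 9.1 (r = 1)].
-/

noncomputable section

open scoped Classical

namespace Summit.BirchSwinnertonDyer.Rank1Residual.X11b.Three.Koly

open WeierstrassCurve NumberField Literature.NumberTheory.EllipticCurves
  Literature.NumberTheory.EllipticCurves.ModularForms
  Literature.NumberTheory.EllipticCurves.Rank1Residual
  Summit.BirchSwinnertonDyer.Rank1Residual Summit.BirchSwinnertonDyer.Rank1Residual.X11b

/-- **`c₁(1) ≢ 0 (mod 3) ⟺ y_K ∉ 3·E(K)`, for every conductor-1 datum of the frame.** Data: `W/ℚ` globally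
minimal, multiplicative at `3` with `ρ̄_{E,3}` onto; `K` imaginary quadratic, Heegner for `N_E`; a frame
`(Dt, β, ι)` with `4N ∣ β² − d_K`; an oriented Heegner datum `H` with `H.β = β` and the Heegner point `P ∈ E(K)`
(`ι(P) = heegnerPointComplex Dt H`); a Kolyvagin–Heegner datum `d` of conductor `1`. BINDERS: Shimura reciprocity at
conductor 1 (`hrec`). Then `d.kolyvaginClass Nat.prime_three 1 ≠ 0 ↔ ¬ ∃ Q, 3 • Q = P` (with `3` written
`((3 ^ 1 : ℕ) : ℤ)`, the tree's torsion-level currency). CONDITIONAL on the binder; nothing is booked.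
[cite: McCallumLMS1991, Cor. 4.5 and §5 Lemma 5.1] [cite: GrossLMS1991, Lemma 4.3, §4] -/
theorem kolyvaginClass_conductorOne_ne_zero_iff_not_divisible
    (W : WeierstrassCurve ℚ) [W.IsElliptic] [W.IsGloballyMinimal] [NeZero (W.conductorNorm ℤ)]
    (K : Type) [Field K] [NumberField K]
    (Dt : ModularParametrizationData W (W.conductorNorm ℤ)) (β : ℤ) (ι : K →+* ℂ)
    (hrec : heegnerPointOfConductor_one_galoisConj (W.conductorNorm ℤ) W K)
    (hmult : W.HasMultiplicativeReductionAtPrime 3) (hρ : Surj W 3)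
    (hK : IsImaginaryQuadratic K) (hH : SatisfiesHeegnerHypothesis (W.conductorNorm ℤ) K)
    {H : HeegnerDatum (W.conductorNorm ℤ) (NumberField.discr K)} (hHβ : H.β = β)
    {P : (W.baseChange K).toAffine.Point}
    (hP : WeierstrassCurve.Affine.Point.map ι.toRatAlgHom P = heegnerPointComplex Dt H)
    (d : KolyvaginHeegnerData Dt β ι 1) :
    d.kolyvaginClass Nat.prime_three 1 ≠ 0 ↔
      ¬ ∃ Q : (W.baseChange K).toAffine.Point, ((3 ^ 1 : ℕ) : ℤ) • Q = P := by
  haveI : Fact (Nat.Prime 3) := ⟨Nat.prime_three⟩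
  -- `P(1) = y_K`: `P` maps to `d.derivedPoint` in `E(K[1])`
  obtain ⟨P₀, -, hP₀⟩ := heegnerSystem_exists_isHeegnerPoint_map_eq_derivedPoint_one hrec hK hH d
  have hP₀P : P₀ = P := KolyvaginBottom.eq_of_map_eq_heegnerPointComplex hrec hK hH d hHβ hP hP₀
  rw [hP₀P] at hP₀
  -- `E(K[1])[3] = 0`
  have htor : ∀ R : (W.baseChange (ringClassField K ι 1)).toAffine.Point, ((3 ^ 1 : ℕ) : ℤ) • R = 0 → R = 0 :=
    fun R hR ↦ RingClassNoTorsion.eq_zero_of_zsmul_pow_eq_zero_ringClassField W hK ι one_ne_zero Nat.prime_three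
      (by norm_num) hρ 1 R hR
  have hiff := pDiv_one_iff_exists_zsmul_eq hK d P hP₀ 3 1 htor
  constructor
  · -- a non-zero class is a certificate: `3 ∤ P(1)`, hence `3 ∤ y_K`
    intro hne hdiv
    exact ((KolyCert.kolyvaginClass_three_ne_zero_iff d hK one_ne_zero hρ 1).mp hne).2 (hiff.mpr hdiv)
  · -- `3 ∤ y_K` ⟹ `3 ∤ P(1)` ⟹ `c₁(1) ≠ 0` by the tower theorem at conductor 1
    intro hndiv
    have hcert : ¬ PDiv d 3 1 := fun h ↦ hndiv (hiff.mp h)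
    let dd : (m : ℕ) → m ∣ 1 → KolyvaginHeegnerData Dt β ι m := fun m hm ↦
      if h : m = 1 then h ▸ d else (h (Nat.dvd_one.mp hm)).elim
    have hd : dd 1 dvd_rfl = d := by
      show (if h : (1 : ℕ) = 1 then h ▸ d else _) = d
      rw [dif_pos rfl]
    have hcert' : ¬ PDiv (dd 1 dvd_rfl) 3 1 := by rwa [hd]
    have hne := KolyCert.kolyvaginClass_three_ne_zero_of_tower_not_pDiv W K Dt β ι hmult hρ hK hH
      (KolyvaginDescent.kolSupp_one _) dd hcert'
    rwa [hd] at hne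

/-- **S1's conclusion from the ONE per-pair input `y_K ∉ 3·E(K)`** (the index certificate: with `E(K)` of rank
one and no 3-torsion this is `3 ∤ [E(K) : ℤ y_K]`). Same data as above, plus Gross 1991 §3 (`h1 h2`) for the
EXISTENCE of a conductor-1 datum on the frame. CONDITIONAL on the binders; nothing is booked.
[cite: McCallumLMS1991, Cor. 4.5, §5 Lemma 5.1] [cite: GrossLMS1991, §3 and §4] -/
theorem exists_kolyvaginClass_conductorOne_ne_zero_of_not_divisible
    (W : WeierstrassCurve ℚ) [W.IsElliptic] [W.IsGloballyMinimal] [NeZero (W.conductorNorm ℤ)]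
    (K : Type) [Field K] [NumberField K]
    (Dt : ModularParametrizationData W (W.conductorNorm ℤ)) (β : ℤ) (ι : K →+* ℂ)
    (hrec : heegnerPointOfConductor_one_galoisConj (W.conductorNorm ℤ) W K)
    (h1 : phi_heegnerPointOfConductor_mem_range_map_ringClassField (W.conductorNorm ℤ) W K)
    (h2 : exists_generator_ringClassGalOver K)
    (hmult : W.HasMultiplicativeReductionAtPrime 3) (hρ : Surj W 3)
    (hK : IsImaginaryQuadratic K) (hH : SatisfiesHeegnerHypothesis (W.conductorNorm ℤ) K)
    (hβ : (4 * (W.conductorNorm ℤ : ℤ)) ∣ β ^ 2 - NumberField.discr K)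
    {H : HeegnerDatum (W.conductorNorm ℤ) (NumberField.discr K)} (hHβ : H.β = β)
    {P : (W.baseChange K).toAffine.Point}
    (hP : WeierstrassCurve.Affine.Point.map ι.toRatAlgHom P = heegnerPointComplex Dt H)
    (hndiv : ¬ ∃ Q : (W.baseChange K).toAffine.Point, ((3 ^ 1 : ℕ) : ℤ) • Q = P) :
    ∃ d : KolyvaginHeegnerData Dt β ι 1, d.kolyvaginClass Nat.prime_three 1 ≠ 0 := by
  obtain ⟨d⟩ := Summit.BirchSwinnertonDyer.BirchSwinnertonDyer.Theorems.nonempty_kolyvaginHeegnerData_of_grossCM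
    h1 h2 hK hH Dt β ι hβ squarefree_one (by simp)
  exact ⟨d, (kolyvaginClass_conductorOne_ne_zero_iff_not_divisible W K Dt β ι hrec hmult hρ hK hH hHβ hP d).mpr
    hndiv⟩

/-- **Conversely, S1's conclusion forces `y_K ∉ 3·E(K)`**: if SOME conductor-1 datum has `c₁(1) ≠ 0` then the
Heegner point of the frame is not 3-divisible in `E(K)`. CONDITIONAL on Shimura reciprocity at conductor 1.
[cite: McCallumLMS1991, Cor. 4.5, §5 Lemma 5.1] -/
theorem not_divisible_of_kolyvaginClass_conductorOne_ne_zero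
    (W : WeierstrassCurve ℚ) [W.IsElliptic] [W.IsGloballyMinimal] [NeZero (W.conductorNorm ℤ)]
    (K : Type) [Field K] [NumberField K]
    (Dt : ModularParametrizationData W (W.conductorNorm ℤ)) (β : ℤ) (ι : K →+* ℂ)
    (hrec : heegnerPointOfConductor_one_galoisConj (W.conductorNorm ℤ) W K)
    (hmult : W.HasMultiplicativeReductionAtPrime 3) (hρ : Surj W 3)
    (hK : IsImaginaryQuadratic K) (hH : SatisfiesHeegnerHypothesis (W.conductorNorm ℤ) K)
    {H : HeegnerDatum (W.conductorNorm ℤ) (NumberField.discr K)} (hHβ : H.β = β)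
    {P : (W.baseChange K).toAffine.Point}
    (hP : WeierstrassCurve.Affine.Point.map ι.toRatAlgHom P = heegnerPointComplex Dt H)
    (h : ∃ d : KolyvaginHeegnerData Dt β ι 1, d.kolyvaginClass Nat.prime_three 1 ≠ 0) :
    ¬ ∃ Q : (W.baseChange K).toAffine.Point, ((3 ^ 1 : ℕ) : ℤ) • Q = P := by
  obtain ⟨d, hd⟩ := h
  exact (kolyvaginClass_conductorOne_ne_zero_iff_not_divisible W K Dt β ι hrec hmult hρ hK hH hHβ hP d).mp hd

end Summit.BirchSwinnertonDyer.Rank1Residual.X11b.Three.Koly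

end
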